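import Literature.Barriers.ResolutionOfSingularities.InseparableBaseChangeResolution
import Literature.AlgebraicGeometry.Resolution.SmoothStalksRegular
import Mathlib.AlgebraicGeometry.Morphisms.Smooth
import Mathlib.AlgebraicGeometry.Morphisms.Proper
import HarnessLib

/-!
# `DescentPerfectToAll` — negative lemma: no smooth model after a finitely generated enlargement

Support (negative) lemma for crux `stmt-ResolutionOfSingularities-0549`
(`Summit.ResolutionOfSingularities.ResolutionOfSingularities.Theses.WeightedInvariant.DescentPerfectToAll`),
line `arc-special-fibre-transversality`, filed by the deep refuter (drefute gen 2).

It closes, with a ZERO-DIMENSIONAL witness, the one `sorry` left in the standing disprover's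
work file `Cruxes/DescentPerfectToAll/Disproof.lean` (§10, `not_smoothModelAfterFGEnlargement`):
the natural strengthening `SmoothModelAfterFGEnlargement p` of the line's core stub
`stub_closedFibreModels` — "after a finitely generated enlargement `K₀ ≤ L ⊆ k` of the field of
definition there is a proper birational model `Y → X₀ ×_{K₀} L` SMOOTH over `L`" (what a witness
`R` = a field, or any `R` with `Frac R ⊇ L'^{perf}`, of that stub would force) — is FALSE for
every prime `p`.

WITNESS. `k = K₀ = 𝔽_p(t)` (so `K₀ = closure {t} = ⊤` and every admissible `L` is `⊤`),
`X₀ = Spec K`, `K = k(t^{1/p})`: reduced, separated, of finite type, and `X₀ ×_{K₀} k ≅ X₀` is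
reduced. A proper birational `π : Y → X₀ ×_{K₀} L ≅ Spec K` is an isomorphism over a dense open of
the one-point target, i.e. over everything, so an open `V ⊆ Y` maps isomorphically onto `Spec K`
and smoothness of `Y → Spec L` gives smoothness of `Spec K → Spec k`; base-changing along itself,
`Spec (K ⊗ₖ K) → Spec K` would be smooth, hence `Spec (K ⊗ₖ K)` regular (Stacks 056S, in tree
`isRegularLocalRing_stalk_of_smooth_of_field`) — but it is the non-reduced inseparable point
(`not_isRegular_pullback_extField`, landed p68332). No curve theory is needed (the disprover's
intended witness was Kollár's regular non-smooth curve `y² = x^p − t`).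

Consequence for the line (unchanged, now kernel-checked): in `stub_closedFibreModels` the local
domain `R` can never be a field, nor have `Frac R ⊇ L'^{perf}`; the arc `φ : L' → Frac R` must be
non-constant.

## Sources
* Q. Liu, Algebraic Geometry and Arithmetic Curves, OUP 2002, Example 3.2.12, Remark 4.3.34.
* The Stacks Project, Tag 056S.
-/

noncomputable section

open CategoryTheory CategoryTheory.Limits AlgebraicGeometry TopologicalSpace
open Literature.AlgebraicGeometry.Resolution
open Literature.Barriers.ResolutionOfSingularities

set_option linter.dupNamespace false

namespace Summit.ResolutionOfSingularities.ResolutionOfSingularities.Theorems.DescentPerfectToAll.Negative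

universe u

/-- `𝔽_p(t)` is generated, as a field, by `t`: `closure {t} = ⊤`. [folklore] -/
theorem subfieldClosure_ratFuncX_eq_top (p : ℕ) [Fact p.Prime] :
    Subfield.closure ((↑({RatFunc.X} : Finset (baseField p))) : Set (baseField p)) = ⊤ := by
  classical
  set S := Subfield.closure ((↑({RatFunc.X} : Finset (baseField p))) : Set (baseField p)) with hS
  rw [eq_top_iff]
  rintro f -
  have hX : (RatFunc.X : baseField p) ∈ S := Subfield.subset_closure (by simp)
  have hpoly : ∀ q : Polynomial (ZMod p),
      algebraMap (Polynomial (ZMod p)) (baseField p) q ∈ S := by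
    intro q
    refine Polynomial.induction_on q ?_ ?_ ?_
    · intro a
      rw [RatFunc.algebraMap_C]
      have : (RatFunc.C a : baseField p) = ((a.val : ℕ) : baseField p) := by
        rw [← map_natCast (RatFunc.C), ZMod.natCast_zmod_val]
      rw [this]
      exact natCast_mem S _
    · intro q r hq hr
      rw [map_add]
      exact add_mem hq hr
    · intro n a h
      rw [pow_succ, ← mul_assoc, map_mul, RatFunc.algebraMap_X]
      exact mul_mem h hX
  rw [← RatFunc.num_div_denom f]
  exact div_mem (hpoly _) (hpoly _)

/-- `Spec` of a bijective ring homomorphism is an isomorphism. [folklore] -/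
theorem isIso_SpecMap_of_bijective {A B : Type u} [CommRing A] [CommRing B] (φ : A →+* B)
    (hφ : Function.Bijective φ) : IsIso (Spec.map (CommRingCat.ofHom φ)) := by
  haveI : IsIso (CommRingCat.ofHom φ) := by
    haveI : IsIso ((forget CommRingCat).map (CommRingCat.ofHom φ)) := by
      rw [isIso_iff_bijective]
      exact hφ
    exact isIso_of_reflects_iso _ (forget CommRingCat)
  infer_instance

/-- **A birational morphism onto a one-point scheme transfers smoothness to the point**: if
`π : Y → P` is birational, `P` has exactly one point, and `Y → P → S` is smooth, then `P → S` is
smooth (the open `π⁻¹ P ⊆ Y` over which `π` is an isomorphism maps isomorphically onto `P`).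
[folklore] -/
theorem smooth_of_isBirational_of_subsingleton {Y P S : Scheme.{u}} (π : Y ⟶ P) (g : P ⟶ S)
    [Subsingleton ↥P] [Nonempty ↥P] (hbir : IsBirational π) (hsm : Smooth (π ≫ g)) :
    Smooth g := by
  obtain ⟨U, hU, -, hUiso⟩ := hbir
  obtain ⟨x, hx⟩ := hU.nonempty
  have hUtop : U = ⊤ := by
    ext y
    simp only [Opens.coe_top, Set.mem_univ, iff_true]
    rw [Subsingleton.elim y x]
    exact hx
  subst hUtop
  haveI := hUiso
  let j : (↑(π ⁻¹ᵁ (⊤ : P.Opens)) : Scheme.{u}) ⟶ P := (π ⁻¹ᵁ (⊤ : P.Opens)).ι ≫ π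
  have hj : j = (π ∣_ (⊤ : P.Opens)) ≫ (⊤ : P.Opens).ι := (morphismRestrict_ι π ⊤).symm
  haveI : IsOpenImmersion j := by rw [hj]; infer_instance
  haveI : Epi j.base := by
    rw [TopCat.epi_iff_surjective]
    intro y
    have x₁ : ↥(↑(π ⁻¹ᵁ (⊤ : P.Opens)) : Scheme.{u}) :=
      (inv (π ∣_ (⊤ : P.Opens))).base ⟨y, trivial⟩
    exact ⟨x₁, Subsingleton.elim _ _⟩
  haveI : IsIso j := IsOpenImmersion.isIso j
  have h1 : Smooth (j ≫ g) := by
    have := IsZariskiLocalAtSource.comp (P := @Smooth) hsm (π ⁻¹ᵁ (⊤ : P.Opens)).ι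
    simpa only [j, Category.assoc] using this
  exact (MorphismProperty.cancel_left_of_respectsIso @Smooth j g).mp h1

/-- **`SmoothModelAfterFGEnlargement p` is false for every prime `p`** (statement = the `def` of
`Cruxes/DescentPerfectToAll/Disproof.lean` §10, unfolded): it is NOT the case that for every field
`k` of characteristic `p`, every finitely generated `K₀ = closure s ⊆ k` and every reduced
separated finite-type `X₀ → Spec K₀` with `X₀ ×_{K₀} k` reduced, some finitely generated
enlargement `K₀ ≤ L = closure t ⊆ k` carries a proper birational `Y → X₀ ×_{K₀} L` with `Y`
smooth over `L`. Witness: `k = K₀ = 𝔽_p(t)`, `X₀ = Spec k(t^{1/p})` (the regular, non-smooth,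
purely inseparable point). [cite: Liu2002, Example 3.2.12 and Remark 4.3.34] -/
theorem not_smoothModelAfterFGEnlargement (p : ℕ) [Fact p.Prime] :
    ¬ ∀ (k : Type) [Field k] [CharP k p] (K₀ : Subfield k) (s : Finset k),
      K₀ = Subfield.closure (↑s : Set k) →
      ∀ (X₀ : Scheme.{0}) (f₀ : X₀ ⟶ Spec (.of K₀)), IsSeparated f₀ → LocallyOfFiniteType f₀ →
        QuasiCompact f₀ → IsReduced X₀ →
        IsReduced (pullback f₀ (Spec.map (CommRingCat.ofHom K₀.subtype))) →
        ∃ (L : Subfield k) (hL : K₀ ≤ L) (t : Finset k), L = Subfield.closure (↑t : Set k) ∧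
          ∃ (Y : Scheme.{0})
            (π : Y ⟶ pullback f₀ (Spec.map (CommRingCat.ofHom (Subfield.inclusion hL)))),
            IsProper π ∧ IsBirational π ∧
              Smooth (π ≫ pullback.snd f₀ (Spec.map (CommRingCat.ofHom (Subfield.inclusion hL)))) := by
  classical
  intro h
  -- ### the witness: `k = 𝔽_p(t)`, `K₀ = closure {t} = ⊤`, `X₀ = Spec K`, `K = k(t^{1/p})`
  let k : Type := baseField p
  let K : Type := extField p
  let K₀ : Subfield k := Subfield.closure ((↑({RatFunc.X} : Finset k)) : Set k)
  have hK₀ : K₀ = ⊤ := subfieldClosure_ratFuncX_eq_top p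
  have hmemK₀ : ∀ x : k, x ∈ K₀ := fun x => by rw [hK₀]; exact Subfield.mem_top x
  let f₁ : Spec (.of K) ⟶ Spec (.of k) := Spec.map (CommRingCat.ofHom (algebraMap k K))
  let σ : Spec (.of k) ⟶ Spec (.of K₀) := Spec.map (CommRingCat.ofHom K₀.subtype)
  let ρ : K₀ →+* K := (algebraMap k K).comp K₀.subtype
  let f₀ : Spec (.of K) ⟶ Spec (.of K₀) := Spec.map (CommRingCat.ofHom ρ)
  have hf₀ : f₀ = f₁ ≫ σ := by
    show Spec.map (CommRingCat.ofHom ((algebraMap k K).comp K₀.subtype)) =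
      Spec.map (CommRingCat.ofHom (algebraMap k K)) ≫ Spec.map (CommRingCat.ofHom K₀.subtype)
    rw [CommRingCat.ofHom_comp, Spec.map_comp]
  -- `K₀.subtype : K₀ → k` is bijective, so `σ` is an isomorphism
  have hbij₀ : Function.Bijective K₀.subtype :=
    ⟨Subtype.val_injective, fun x => ⟨⟨x, hmemK₀ x⟩, rfl⟩⟩
  haveI hσ : IsIso (Spec.map (CommRingCat.ofHom K₀.subtype)) := isIso_SpecMap_of_bijective _ hbij₀
  -- hypotheses of `h` at the witness
  have hlft : LocallyOfFiniteType f₀ := by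
    show LocallyOfFiniteType (Spec.map (CommRingCat.ofHom ρ))
    rw [HasRingHomProperty.Spec_iff (P := @LocallyOfFiniteType), CommRingCat.hom_ofHom]
    exact RingHom.FiniteType.comp (RingHom.finiteType_algebraMap.mpr inferInstance)
      (RingHom.FiniteType.of_surjective _ hbij₀.2)
  have hredb : IsReduced (pullback f₀ (Spec.map (CommRingCat.ofHom K₀.subtype))) :=
    isReduced_of_isOpenImmersion (pullback.fst f₀ (Spec.map (CommRingCat.ofHom K₀.subtype)))
  obtain ⟨L, hL, t, -, Y, π, -, hbir, hsm⟩ :=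
    h k K₀ {RatFunc.X} rfl (Spec (.of K)) f₀ inferInstance hlft inferInstance inferInstance hredb
  -- ### `L = ⊤` as well: `ι : Spec L → Spec K₀` is an isomorphism and `X₀ ×_{K₀} L ≅ Spec K`
  have hbijι : Function.Bijective (Subfield.inclusion hL) :=
    ⟨(Subfield.inclusion hL).injective, fun x => ⟨⟨(x : k), hmemK₀ x⟩, Subtype.ext rfl⟩⟩
  haveI hι : IsIso (Spec.map (CommRingCat.ofHom (Subfield.inclusion hL))) :=
    isIso_SpecMap_of_bijective _ hbijι
  haveI hfst : IsIso (pullback.fst f₀ (Spec.map (CommRingCat.ofHom (Subfield.inclusion hL)))) :=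
    inferInstance
  haveI hPsub : Subsingleton ↥(pullback f₀ (Spec.map (CommRingCat.ofHom (Subfield.inclusion hL)))) := by
    haveI : Subsingleton ↥(Spec (CommRingCat.of K)) :=
      inferInstanceAs (Subsingleton (PrimeSpectrum K))
    exact (pullback.fst f₀
      (Spec.map (CommRingCat.ofHom (Subfield.inclusion hL)))).isOpenEmbedding.injective.subsingleton
  have xK : ↥(Spec (CommRingCat.of K)) := (⟨⊥, Ideal.isPrime_bot⟩ : PrimeSpectrum K)
  haveI hPne : Nonempty ↥(pullback f₀ (Spec.map (CommRingCat.ofHom (Subfield.inclusion hL)))) :=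
    ⟨(inv (pullback.fst f₀ (Spec.map (CommRingCat.ofHom (Subfield.inclusion hL))))).base xK⟩
  -- ### smoothness descends: `Y → Spec L` smooth ⇒ `X₀ ×_{K₀} L → Spec L` ⇒ `Spec K → Spec k`
  have h2 : Smooth (pullback.snd f₀ (Spec.map (CommRingCat.ofHom (Subfield.inclusion hL)))) :=
    smooth_of_isBirational_of_subsingleton π _ hbir hsm
  have h3 : Smooth (pullback.fst f₀ (Spec.map (CommRingCat.ofHom (Subfield.inclusion hL))) ≫ f₀) := by
    rw [pullback.condition]
    exact (MorphismProperty.cancel_right_of_respectsIso @Smooth _ _).mpr h2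
  have h4 : Smooth f₀ := (MorphismProperty.cancel_left_of_respectsIso @Smooth _ f₀).mp h3
  have h5 : Smooth f₁ := by
    rw [hf₀] at h4
    exact (MorphismProperty.cancel_right_of_respectsIso @Smooth f₁ σ).mp h4
  -- ### base change along itself: `Spec (K ⊗ₖ K) → Spec K` smooth ⇒ `Spec (K ⊗ₖ K)` regular — absurd
  have h6 : Smooth (pullback.snd f₁ f₁) := MorphismProperty.pullback_snd (P := @Smooth) f₁ f₁ h5
  have h7 : Scheme.IsRegular (pullback f₁ f₁) := fun x =>
    @isRegularLocalRing_stalk_of_smooth_of_field K _ _ (pullback.snd f₁ f₁) h6 x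
  exact not_isRegular_pullback_extField p h7

end Summit.ResolutionOfSingularities.ResolutionOfSingularities.Theorems.DescentPerfectToAll.Negative

end
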